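import Mathlib
import Summits.NavierStokesRegularity.NavierStokesRegularity.Theorems.DssFarFieldSlavingBlowupTypeIDssProfileSimilarityEnstrophyHardyCore
import HarnessLib

/-!
# Route StretchingWellBinding — support item `DssProfileBinding` (stmt-NavierStokesRegularity-1578),
  helper file 3/4: test fields for the stretching Rayleigh quotient (cut-off truncation and the
  sharp Hardy step)

The two elementary facts about the Rayleigh quotient `∫ α₊|ψ|² − ∫|∇ψ|²_F` of the stretching
well that the item `Theses.StretchingWellBinding.DssProfileBinding` needs:

* `tendsto_rayleigh_cutoff`: for a smooth field `W` with `|W|², |∇W|²_F ∈ L¹` and a bounded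
  measurable weight `a`, the truncations `ψ_n = χ_{n+1} W` (`χ_R` the tree's standard cut-off
  `cutoff R`) have `∫ a|ψ_n|² − ∫|∇ψ_n|²_F → ∫ a|W|² − ∫|∇W|²_F` (dominated convergence; `χ_R = 1`
  near every fixed point for `R` large, `‖∇χ_R‖ ≤ c/R`);
* `integral_weight_mul_norm_sq_le_of_hardySubcritical`: if `0 ≤ a` and `‖x − x₀‖² a(x) ≤ ¼`
  for all `x` (one centre `x₀`), then `∫ a|ψ|² ≤ ∫|∇ψ|²_F` for every `C¹` compactly supported
  vector test field `ψ` — the sharp Hardy inequality on `ℝ³` (constant `4`, centred, componentwise: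
  the cell pub-ns-dss tool `SimilarityEnstrophy.hardy_sq_lintegral_sub_le_of_decay_vec`) turns a
  Hardy-subcritical well into a non-binding one (`4 · ¼ = 1`);
* the pointwise dictionary between the stretching pairing `⟪ω, Du ω⟫` and the route's stretching
  rate `α = ⟪ξ, Du ξ⟫`, `ξ = ω/|ω|` (`inner_vorticityDirection_clm_apply`,
  `inner_clm_apply_self_le_posPart_mul`, measurability and bounds of `α₊`).

HONEST FRAMING: elementary real analysis about arbitrary test fields; nothing here bears on
Navier–Stokes regularity. Lands `--supports stmt-NavierStokesRegularity-1578` (other route;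
label-free; typer seat g19 of cell pub-ns-dss, idle-row item). Idea credit: the route card
`stretching-well-binding` (F3) and Vazquez–Zuazua 2000 (Hardy `¼`).
-/

noncomputable section

set_option linter.dupNamespace false

namespace Summit.NavierStokesRegularity.NavierStokesRegularity.Theorems.DssBinding

open MeasureTheory Set Filter Topology Module Metric InnerProductSpace Function
open scoped RealInnerProductSpace Laplacian ContDiff ENNReal
open Literature.Analysis Literature.Analysis.FluidPDE
open Summit.NavierStokesRegularity.NavierStokesRegularity.Theorems.SimilarityEnstrophy

/-! ### The stretching rate `α = ⟪ξ, L ξ⟫` versus the stretching pairing `⟪ω, L ω⟫` -/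

/-- `⟪ξ(x), L ξ(x)⟫ = ⟪ω(x), L ω(x)⟫ / ‖ω(x)‖²` for the vorticity direction `ξ = ω/|ω|` (both sides
vanish where `ω(x) = 0`). [folklore] -/
theorem inner_vorticityDirection_clm_apply (Ω : EuclideanSpace ℝ (Fin 3) → EuclideanSpace ℝ (Fin 3))
    (L : EuclideanSpace ℝ (Fin 3) →L[ℝ] EuclideanSpace ℝ (Fin 3)) (x : EuclideanSpace ℝ (Fin 3)) :
    ⟪vorticityDirection Ω x, L (vorticityDirection Ω x)⟫ = ⟪Ω x, L (Ω x)⟫ / ‖Ω x‖ ^ 2 := by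
  rw [vorticityDirection_apply, map_smul, real_inner_smul_left, real_inner_smul_right, div_eq_mul_inv,
    ← inv_pow, sq]
  ring

/-- `⟪ω(x), L ω(x)⟫ ≤ α₊(x) ‖ω(x)‖²` with `α = ⟪ξ, L ξ⟫`, `ξ = ω/|ω|`. [folklore] -/
theorem inner_clm_apply_self_le_posPart_mul (Ω : EuclideanSpace ℝ (Fin 3) → EuclideanSpace ℝ (Fin 3))
    (L : EuclideanSpace ℝ (Fin 3) →L[ℝ] EuclideanSpace ℝ (Fin 3)) (x : EuclideanSpace ℝ (Fin 3)) :
    ⟪Ω x, L (Ω x)⟫ ≤ max 0 ⟪vorticityDirection Ω x, L (vorticityDirection Ω x)⟫ * ‖Ω x‖ ^ 2 := by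
  rw [inner_vorticityDirection_clm_apply]
  by_cases hx : Ω x = 0
  · simp [hx]
  · have hpos : 0 < ‖Ω x‖ ^ 2 := by positivity
    calc ⟪Ω x, L (Ω x)⟫ = ⟪Ω x, L (Ω x)⟫ / ‖Ω x‖ ^ 2 * ‖Ω x‖ ^ 2 := by field_simp
      _ ≤ max 0 (⟪Ω x, L (Ω x)⟫ / ‖Ω x‖ ^ 2) * ‖Ω x‖ ^ 2 :=
          mul_le_mul_of_nonneg_right (le_max_right _ _) hpos.le

/-- `|⟪ξ(x), L ξ(x)⟫| ≤ ‖L‖` (`‖ξ‖ ≤ 1`). [folklore] -/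
theorem abs_inner_vorticityDirection_clm_apply_le
    (Ω : EuclideanSpace ℝ (Fin 3) → EuclideanSpace ℝ (Fin 3))
    (L : EuclideanSpace ℝ (Fin 3) →L[ℝ] EuclideanSpace ℝ (Fin 3)) (x : EuclideanSpace ℝ (Fin 3)) :
    |⟪vorticityDirection Ω x, L (vorticityDirection Ω x)⟫| ≤ ‖L‖ := by
  have hξ : ‖vorticityDirection Ω x‖ ≤ 1 := by
    by_cases hx : Ω x = 0
    · rw [(vorticityDirection_eq_zero_iff Ω x).2 hx, norm_zero]; exact zero_le_one
    · exact (norm_vorticityDirection Ω hx).le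
  calc |⟪vorticityDirection Ω x, L (vorticityDirection Ω x)⟫|
      ≤ ‖vorticityDirection Ω x‖ * ‖L (vorticityDirection Ω x)‖ := abs_real_inner_le_norm _ _
    _ ≤ 1 * (‖L‖ * 1) := by
        refine mul_le_mul hξ ((L.le_opNorm _).trans ?_) (norm_nonneg _) zero_le_one
        exact mul_le_mul_of_nonneg_left hξ (norm_nonneg _)
    _ = ‖L‖ := by ring

/-- The positive part `α₊ = max 0 ⟪ξ, Dw ξ⟫` of the stretching rate of a `C¹` field is measurable
(`α = ⟪ω, Dw ω⟫/‖ω‖²` is a quotient of continuous functions). [folklore] -/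
theorem measurable_posPart_stretchingRate {w Ω : EuclideanSpace ℝ (Fin 3) → EuclideanSpace ℝ (Fin 3)}
    (hw : ContDiff ℝ 1 w) (hΩ : Continuous Ω) :
    Measurable fun x => max 0 ⟪vorticityDirection Ω x, fderiv ℝ w x (vorticityDirection Ω x)⟫ := by
  have hc : Continuous fun x => ⟪Ω x, fderiv ℝ w x (Ω x)⟫ :=
    hΩ.inner ((hw.continuous_fderiv one_ne_zero).clm_apply hΩ)
  have e : (fun x => max 0 ⟪vorticityDirection Ω x, fderiv ℝ w x (vorticityDirection Ω x)⟫) =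
      fun x => max 0 (⟪Ω x, fderiv ℝ w x (Ω x)⟫ / ‖Ω x‖ ^ 2) := by
    funext x; rw [inner_vorticityDirection_clm_apply]
  rw [e]
  exact measurable_const.max (hc.measurable.div ((hΩ.norm).pow 2).measurable)

/-! ### Truncation: `∫ a|χ_R W|² − ∫|∇(χ_R W)|²_F → ∫ a|W|² − ∫|∇W|²_F` -/

/-- `‖s • v + r • w‖² ≤ 2 s² ‖v‖² + 2 r² ‖w‖²`. [folklore] -/
theorem norm_smul_add_smul_sq_le {F : Type*} [NormedAddCommGroup F] [NormedSpace ℝ F]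
    (s r : ℝ) (v w : F) : ‖s • v + r • w‖ ^ 2 ≤ 2 * s ^ 2 * ‖v‖ ^ 2 + 2 * r ^ 2 * ‖w‖ ^ 2 := by
  have h := norm_add_le (s • v) (r • w)
  rw [norm_smul, norm_smul, Real.norm_eq_abs, Real.norm_eq_abs] at h
  have h1 : 0 ≤ |s| * ‖v‖ := by positivity
  have h2 : 0 ≤ |r| * ‖w‖ := by positivity
  nlinarith [sq_abs s, sq_abs r, norm_nonneg (s • v + r • w), sq_nonneg (|s| * ‖v‖ - |r| * ‖w‖)]

/-- For `R > ‖x‖` the truncation `χ_R W` agrees with `W` near `x`. [folklore] -/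
theorem cutoff_smul_eventuallyEq {W : EuclideanSpace ℝ (Fin 3) → EuclideanSpace ℝ (Fin 3)}
    {R : ℝ} {x : EuclideanSpace ℝ (Fin 3)} (hR : ‖x‖ < R) :
    (fun y => cutoff R y • W y) =ᶠ[𝓝 x] W := by
  have hR0 : 0 < R := (norm_nonneg x).trans_lt hR
  filter_upwards [Metric.isOpen_ball.mem_nhds (mem_ball_zero_iff.2 hR)] with y hy
  rw [cutoff_eq_one hR0 (mem_ball_zero_iff.1 hy).le, one_smul]

/-- The Frobenius norm of the derivative of a `C¹` field is continuous. [folklore] -/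
theorem continuous_frobeniusNormSq_fderiv {f : EuclideanSpace ℝ (Fin 3) → EuclideanSpace ℝ (Fin 3)}
    (hf : ContDiff ℝ 1 f) : Continuous fun x => frobeniusNormSq (fderiv ℝ f x) := by
  unfold frobeniusNormSq
  exact continuous_finsetSum _ fun i _ =>
    (((hf.continuous_fderiv one_ne_zero).clm_apply continuous_const).norm).pow 2

/-- **Truncation of the Rayleigh quotient.** For a smooth field `W` on `ℝ³` with `|W|²` and
`|∇W|²_F` integrable and a measurable weight `a` with `|a| ≤ A`, the truncations
`ψ_n = χ_{n+1} W` satisfy `∫ a|ψ_n|² − ∫|∇ψ_n|²_F → ∫ a|W|² − ∫|∇W|²_F` (dominated convergence: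
`χ_{n+1} = 1` near each fixed point eventually, `|χ| ≤ 1`, `‖∇χ_R‖ ≤ c/R ≤ c`, so
`|∇ψ_n|²_F ≤ 6c²|W|² + 2|∇W|²_F`). [folklore] -/
theorem tendsto_rayleigh_cutoff {W : EuclideanSpace ℝ (Fin 3) → EuclideanSpace ℝ (Fin 3)}
    (hW : ContDiff ℝ ∞ W) (hW2 : Integrable fun x => ‖W x‖ ^ 2)
    (hF : Integrable fun x => frobeniusNormSq (fderiv ℝ W x))
    {a : EuclideanSpace ℝ (Fin 3) → ℝ} (ha : Measurable a) {A : ℝ} (haA : ∀ x, |a x| ≤ A) :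
    Tendsto (fun n : ℕ => (∫ x, a x * ‖cutoff ((n : ℝ) + 1) x • W x‖ ^ 2)
        - ∫ x, frobeniusNormSq (fderiv ℝ (fun y => cutoff ((n : ℝ) + 1) y • W y) x)) atTop
      (𝓝 ((∫ x, a x * ‖W x‖ ^ 2) - ∫ x, frobeniusNormSq (fderiv ℝ W x))) := by
  obtain ⟨c, hc0, hc⟩ := exists_norm_fderiv_cutoff_le (E := EuclideanSpace ℝ (Fin 3))
  have hW1 : ContDiff ℝ 1 W := hW.of_le (by norm_cast)
  have hWd : Differentiable ℝ W := hW1.differentiable one_ne_zero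
  have hχ : ∀ n : ℕ, ContDiff ℝ ∞ (cutoff (E := EuclideanSpace ℝ (Fin 3)) ((n : ℝ) + 1)) :=
    fun n => contDiff_cutoff _
  have hψ : ∀ n : ℕ, ContDiff ℝ ∞ (fun y => cutoff ((n : ℝ) + 1) y • W y) :=
    fun n => (hχ n).smul hW
  have hA : 0 ≤ A := (abs_nonneg _).trans (haA 0)
  refine Tendsto.sub ?_ ?_
  · -- the weighted mass
    refine tendsto_integral_of_dominated_convergence (fun x => A * ‖W x‖ ^ 2) (fun n => ?_)
      (hW2.const_mul A) (fun n => Eventually.of_forall fun x => ?_) (Eventually.of_forall fun x => ?_)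
    · exact (ha.aestronglyMeasurable.mul
        ((((hχ n).continuous.smul hW.continuous).norm.pow 2).aestronglyMeasurable))
    · rw [norm_mul, Real.norm_eq_abs, norm_pow, norm_norm, norm_smul, mul_pow, Real.norm_eq_abs]
      have h1 : |cutoff ((n : ℝ) + 1) x| ^ 2 ≤ 1 := by
        have := abs_cutoff_le_one ((n : ℝ) + 1) x
        nlinarith [abs_nonneg (cutoff ((n : ℝ) + 1) x)]
      calc |a x| * (|cutoff ((n : ℝ) + 1) x| ^ 2 * ‖W x‖ ^ 2)
          ≤ A * (1 * ‖W x‖ ^ 2) := mul_le_mul (haA x)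
            (mul_le_mul_of_nonneg_right h1 (sq_nonneg _)) (by positivity) hA
        _ = A * ‖W x‖ ^ 2 := by ring
    · have h := (((tendsto_cutoff_natCast_add_one x).smul
        (tendsto_const_nhds (x := W x))).norm.pow 2).const_mul (a x)
      simpa only [one_smul] using h
  · -- the dissipation
    refine tendsto_integral_of_dominated_convergence
      (fun x => 6 * c ^ 2 * ‖W x‖ ^ 2 + 2 * frobeniusNormSq (fderiv ℝ W x)) (fun n => ?_)
      ((hW2.const_mul _).add (hF.const_mul 2)) (fun n => Eventually.of_forall fun x => ?_)
      (Eventually.of_forall fun x => ?_)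
    · exact (continuous_frobeniusNormSq_fderiv ((hψ n).of_le (by norm_cast))).aestronglyMeasurable
    · have hn1 : (1 : ℝ) ≤ (n : ℝ) + 1 := by
        have : (0 : ℝ) ≤ n := n.cast_nonneg
        linarith
      have hn0 : (0 : ℝ) < (n : ℝ) + 1 := by linarith
      have hDχ : ‖fderiv ℝ (cutoff ((n : ℝ) + 1)) x‖ ≤ c :=
        (hc _ hn0 x).trans (div_le_self hc0 hn1)
      rw [Real.norm_of_nonneg (frobeniusNormSq_nonneg _)]
      unfold frobeniusNormSq
      have hterm : ∀ i, ‖fderiv ℝ (fun y => cutoff ((n : ℝ) + 1) y • W y) x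
          (stdOrthonormalBasis ℝ (EuclideanSpace ℝ (Fin 3)) i)‖ ^ 2 ≤
          2 * c ^ 2 * ‖W x‖ ^ 2 +
            2 * ‖fderiv ℝ W x (stdOrthonormalBasis ℝ (EuclideanSpace ℝ (Fin 3)) i)‖ ^ 2 := by
        intro i
        set e := stdOrthonormalBasis ℝ (EuclideanSpace ℝ (Fin 3)) i with he
        rw [fderiv_smul_apply_of_differentiableAt (((hχ n).differentiable (by simp)) x) (hWd x) e]
        refine (norm_smul_add_smul_sq_le _ _ _ _).trans ?_
        have h1 : (fderiv ℝ (cutoff ((n : ℝ) + 1)) x e) ^ 2 ≤ c ^ 2 := by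
          have h2 : |fderiv ℝ (cutoff ((n : ℝ) + 1)) x e| ≤ c := by
            rw [← Real.norm_eq_abs]
            calc ‖fderiv ℝ (cutoff ((n : ℝ) + 1)) x e‖
                ≤ ‖fderiv ℝ (cutoff ((n : ℝ) + 1)) x‖ * ‖e‖ := ContinuousLinearMap.le_opNorm _ _
              _ ≤ c * 1 := by
                  rw [he, (stdOrthonormalBasis ℝ (EuclideanSpace ℝ (Fin 3))).orthonormal.1 i]
                  exact mul_le_mul_of_nonneg_right hDχ zero_le_one
              _ = c := mul_one c
          nlinarith [abs_nonneg (fderiv ℝ (cutoff ((n : ℝ) + 1)) x e), sq_abs (fderiv ℝ (cutoff ((n : ℝ) + 1)) x e)]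
        have h3 : (cutoff ((n : ℝ) + 1) x) ^ 2 ≤ 1 := by
          have := abs_cutoff_le_one ((n : ℝ) + 1) x
          nlinarith [abs_nonneg (cutoff ((n : ℝ) + 1) x), sq_abs (cutoff ((n : ℝ) + 1) x)]
        nlinarith [sq_nonneg ‖W x‖, sq_nonneg ‖fderiv ℝ W x e‖, h1, h3,
          mul_le_mul_of_nonneg_right h1 (sq_nonneg ‖W x‖),
          mul_le_mul_of_nonneg_right h3 (sq_nonneg ‖fderiv ℝ W x e‖)]
      calc ∑ i, ‖fderiv ℝ (fun y => cutoff ((n : ℝ) + 1) y • W y) x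
              (stdOrthonormalBasis ℝ (EuclideanSpace ℝ (Fin 3)) i)‖ ^ 2
          ≤ ∑ i, (2 * c ^ 2 * ‖W x‖ ^ 2 +
              2 * ‖fderiv ℝ W x (stdOrthonormalBasis ℝ (EuclideanSpace ℝ (Fin 3)) i)‖ ^ 2) :=
            Finset.sum_le_sum fun i _ => hterm i
        _ = 6 * c ^ 2 * ‖W x‖ ^ 2 +
              2 * ∑ i, ‖fderiv ℝ W x (stdOrthonormalBasis ℝ (EuclideanSpace ℝ (Fin 3)) i)‖ ^ 2 := by
            rw [Finset.sum_add_distrib, Finset.sum_const, Finset.card_univ, ← Finset.mul_sum]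
            simp only [Fintype.card_fin, finrank_euclideanSpace_fin, nsmul_eq_mul]
            push_cast
            ring
    · -- eventually constant
      refine tendsto_const_nhds.congr' ?_
      have hev : ∀ᶠ n : ℕ in atTop, ‖x‖ < (n : ℝ) + 1 :=
        (tendsto_natCast_atTop_atTop.atTop_add tendsto_const_nhds :
          Tendsto (fun n : ℕ => (n : ℝ) + 1) atTop atTop).eventually_gt_atTop ‖x‖
      filter_upwards [hev] with n hn
      rw [(cutoff_smul_eventuallyEq (W := W) hn).fderiv_eq]

/-! ### The sharp Hardy step for compactly supported test fields -/

/-- **A Hardy-subcritical well does not bind.** If `0 ≤ a` and `‖x − x₀‖² a(x) ≤ ¼` for all `x`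
(one centre `x₀`), then `∫ a|ψ|² ≤ ∫|∇ψ|²_F` for every `C¹` compactly supported vector test field
`ψ` on `ℝ³` (the sharp Hardy inequality `∫|ψ|²/|x−x₀|² ≤ 4∫|∇ψ|²_F`, componentwise and centred:
`SimilarityEnstrophy.hardy_sq_lintegral_sub_le_of_decay_vec`; `4 · ¼ = 1`).
[cite: VazquezZuazua2000, §1 (Hardy's inequality with the optimal constant (N−2)²/4)] -/
theorem integral_weight_mul_norm_sq_le_of_hardySubcritical
    {ψ : EuclideanSpace ℝ (Fin 3) → EuclideanSpace ℝ (Fin 3)} (hψ : ContDiff ℝ 1 ψ)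
    (hψc : HasCompactSupport ψ) {a : EuclideanSpace ℝ (Fin 3) → ℝ} (x₀ : EuclideanSpace ℝ (Fin 3))
    (ha0 : ∀ x, 0 ≤ a x) (ha : ∀ x, ‖x - x₀‖ ^ 2 * a x ≤ 1 / 4) :
    ∫ x, a x * ‖ψ x‖ ^ 2 ≤ ∫ x, frobeniusNormSq (fderiv ℝ ψ x) := by
  -- `ψ` vanishes outside a ball about `x₀`
  obtain ⟨R₀, hR₀⟩ := (hψc.isCompact.isBounded).subset_closedBall x₀
  set R₁ : ℝ := max R₀ 1 with hR₁
  have hR₁0 : 0 < R₁ := lt_of_lt_of_le one_pos (le_max_right _ _)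
  have hdec : ∀ y : EuclideanSpace ℝ (Fin 3), R₁ < ‖y - x₀‖ → ‖y - x₀‖ * ‖ψ y‖ ≤ 0 := by
    intro y hy
    have hy' : y ∉ tsupport ψ := fun h => by
      have := hR₀ h
      rw [mem_closedBall, dist_eq_norm] at this
      linarith [le_max_left R₀ 1]
    rw [image_eq_zero_of_notMem_tsupport hy', norm_zero, mul_zero]
  -- Hardy, `ℝ≥0∞` form, and the Frobenius dictionary
  have hH := hardy_sq_lintegral_sub_le_of_decay_vec hψ x₀ hR₁0 hdec
  have hFc : Continuous fun y => frobeniusNormSq (fderiv ℝ ψ y) := continuous_frobeniusNormSq_fderiv hψ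
  have hFcs : HasCompactSupport
      ((fun L : EuclideanSpace ℝ (Fin 3) →L[ℝ] EuclideanSpace ℝ (Fin 3) => frobeniusNormSq L) ∘
        fderiv ℝ ψ) :=
    (hψc.fderiv (𝕜 := ℝ)).comp_left frobeniusNormSq_zero
  have iF : Integrable fun y => frobeniusNormSq (fderiv ℝ ψ y) :=
    hFc.integrable_of_hasCompactSupport hFcs
  have hsum : ∑ i, ∫⁻ y, ENNReal.ofReal (‖fderiv ℝ (fun z => ψ z i) y‖ ^ 2) =
      ∫⁻ y, ENNReal.ofReal (frobeniusNormSq (fderiv ℝ ψ y)) := by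
    rw [← lintegral_finsetSum _ fun i _ => ?_]
    · refine lintegral_congr fun y => ?_
      rw [frobeniusNormSq_fderiv_eq_sum_norm_fderiv_coord_sq ((hψ.differentiable one_ne_zero) y),
        ENNReal.ofReal_sum_of_nonneg fun i _ => sq_nonneg _]
    · exact ((((contDiff_euclidean.1 hψ i).continuous_fderiv one_ne_zero).norm).pow
        2).measurable.ennreal_ofReal
  have hFlin : ∫⁻ y, ENNReal.ofReal (frobeniusNormSq (fderiv ℝ ψ y)) =
      ENNReal.ofReal (∫ y, frobeniusNormSq (fderiv ℝ ψ y)) :=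
    (ofReal_integral_eq_lintegral_ofReal iF (Eventually.of_forall fun y => frobeniusNormSq_nonneg _)).symm
  rw [hsum, hFlin] at hH
  -- the majorant `h = |ψ|²/|y − x₀|²` is integrable with `∫ h ≤ 4 ∫ |∇ψ|²_F`
  set h : EuclideanSpace ℝ (Fin 3) → ℝ := fun y => ‖ψ y‖ ^ 2 / ‖y - x₀‖ ^ 2 with hh
  have hmeas : AEStronglyMeasurable h volume :=
    ((hψ.continuous.norm.pow 2).measurable.div
      ((continuous_norm.comp (continuous_id.sub continuous_const)).pow 2).measurable).aestronglyMeasurable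
  have hnn : 0 ≤ᵐ[volume] h := Eventually.of_forall fun y => by positivity
  have hfin : ∫⁻ y, ENNReal.ofReal (h y) < (⊤ : ℝ≥0∞) :=
    lt_of_le_of_lt hH (ENNReal.mul_lt_top (by norm_num) ENNReal.ofReal_lt_top)
  have hint : Integrable h := by
    refine ⟨hmeas, ?_⟩
    rw [hasFiniteIntegral_iff_norm]
    refine lt_of_le_of_lt (le_of_eq ?_) hfin
    refine lintegral_congr fun y => ?_
    rw [Real.norm_of_nonneg (by positivity)]
  have hle : ∫ y, h y ≤ 4 * ∫ y, frobeniusNormSq (fderiv ℝ ψ y) := by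
    have e1 : ENNReal.ofReal (∫ y, h y) ≤ 4 * ENNReal.ofReal (∫ y, frobeniusNormSq (fderiv ℝ ψ y)) := by
      rw [ofReal_integral_eq_lintegral_ofReal hint hnn]; exact hH
    have hFnn : 0 ≤ ∫ y, frobeniusNormSq (fderiv ℝ ψ y) := integral_nonneg fun y => frobeniusNormSq_nonneg _
    rw [show (4 : ℝ≥0∞) = ENNReal.ofReal 4 by norm_num, ← ENNReal.ofReal_mul (by norm_num)] at e1
    exact (ENNReal.ofReal_le_ofReal_iff (by positivity)).1 e1
  -- pointwise (a.e., off the centre): `a|ψ|² ≤ ¼ h`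
  have hae : ∀ᵐ y ∂volume, a y * ‖ψ y‖ ^ 2 ≤ (1 / 4) * h y := by
    have hy₀ : ∀ᵐ y ∂(volume : Measure (EuclideanSpace ℝ (Fin 3))), y ≠ x₀ := by
      have : (volume : Measure (EuclideanSpace ℝ (Fin 3))) {x₀} = 0 := measure_singleton x₀
      refine ae_iff.2 ?_
      simp only [ne_eq, not_not, setOf_eq_eq_singleton]
      exact this
    filter_upwards [hy₀] with y hy
    have hpos : 0 < ‖y - x₀‖ ^ 2 := by
      have : 0 < ‖y - x₀‖ := norm_pos_iff.2 (sub_ne_zero.2 hy)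
      positivity
    have hay : a y ≤ (1 / 4) / ‖y - x₀‖ ^ 2 := by
      rw [le_div_iff₀ hpos, mul_comm]; exact ha y
    calc a y * ‖ψ y‖ ^ 2 ≤ ((1 / 4) / ‖y - x₀‖ ^ 2) * ‖ψ y‖ ^ 2 :=
          mul_le_mul_of_nonneg_right hay (sq_nonneg _)
      _ = (1 / 4) * h y := by simp only [hh]; ring
  have hmono : ∫ y, a y * ‖ψ y‖ ^ 2 ≤ ∫ y, (1 / 4) * h y :=
    integral_mono_of_nonneg (Eventually.of_forall fun y => mul_nonneg (ha0 y) (sq_nonneg _))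
      (hint.const_mul _) hae
  rw [integral_const_mul] at hmono
  linarith

end Summit.NavierStokesRegularity.NavierStokesRegularity.Theorems.DssBinding

end
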